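import Mathlib
import HarnessLib

/-!
# Mixed coefficients of a bounded observable against a family of bounded observables (moment recursion)

Helper definitions for stub `stub_derivToMoments` of line `Sketch` (coupling response) of crux `HypercubicLimit`
(stmt-QuantumFields-16154).  For a finite measure `μ`, an observable `X` and a finset-indexed family `Y`, the
MIXED COEFFICIENTS `A_X(s)` (`mixedCoeff μ X Y s`) are defined by the moment recursion
`∫ X ∏_{i∈s} Yᵢ dμ = Σ_{t ⊆ s} A_X(t) · ∫ ∏_{i∈s∖t} Yᵢ dμ` (well-founded on `⊊`); for a probability measure they are the
joint cumulants `κ(X; Y_s)`, but no cumulant theory is used or claimed.  This file: the recursion, locality, linearity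
in each slot, invariance under relabelling, and the packaging as a symmetric multilinear map on bounded measurable
functions (`mixedCoeffML`), which is what sign polarisation consumes.
-/

noncomputable section

open MeasureTheory Finset

namespace Summit.QuantumFields.YangMills.Cruxes.HypercubicLimit.CouplingResponse

/-! ## Bounded measurable real functions -/

section BddMeas

variable {Ω : Type*} [MeasurableSpace Ω]

/-- A real function is **bounded measurable**: measurable with a uniform bound. [folklore] -/
def IsBddMeas (f : Ω → ℝ) : Prop := Measurable f ∧ ∃ C, ∀ ω, |f ω| ≤ C

namespace IsBddMeas

variable {f g : Ω → ℝ}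

/-- Constants are bounded measurable. [folklore] -/
theorem const (c : ℝ) : IsBddMeas (fun _ : Ω => c) := ⟨measurable_const, |c|, fun _ => le_rfl⟩

/-- Sums of bounded measurable functions are bounded measurable. [folklore] -/
theorem add (hf : IsBddMeas f) (hg : IsBddMeas g) : IsBddMeas (f + g) := by
  obtain ⟨hfm, C, hC⟩ := hf
  obtain ⟨hgm, D, hD⟩ := hg
  refine ⟨hfm.add hgm, C + D, fun ω => ?_⟩
  simp only [Pi.add_apply]
  exact (abs_add_le _ _).trans (add_le_add (hC ω) (hD ω))

/-- Scalar multiples of bounded measurable functions are bounded measurable. [folklore] -/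
theorem smul (c : ℝ) (hf : IsBddMeas f) : IsBddMeas (c • f) := by
  obtain ⟨hfm, C, hC⟩ := hf
  refine ⟨hfm.const_smul c, |c| * C, fun ω => ?_⟩
  simp only [Pi.smul_apply, smul_eq_mul, abs_mul]
  exact mul_le_mul_of_nonneg_left (hC ω) (abs_nonneg c)

/-- Products of bounded measurable functions are bounded measurable. [folklore] -/
theorem mul (hf : IsBddMeas f) (hg : IsBddMeas g) : IsBddMeas (fun ω => f ω * g ω) := by
  obtain ⟨hfm, C, hC⟩ := hf
  obtain ⟨hgm, D, hD⟩ := hg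
  refine ⟨hfm.mul hgm, C * D, fun ω => ?_⟩
  rw [abs_mul]
  exact mul_le_mul (hC ω) (hD ω) (abs_nonneg _) ((abs_nonneg _).trans (hC ω))

/-- Finite products of bounded measurable functions are bounded measurable. [folklore] -/
theorem prod {ι : Type*} (s : Finset ι) {Y : ι → Ω → ℝ} (hY : ∀ i ∈ s, IsBddMeas (Y i)) :
    IsBddMeas (fun ω => ∏ i ∈ s, Y i ω) := by
  classical
  induction s using Finset.induction_on with
  | empty => simpa using IsBddMeas.const (Ω := Ω) 1
  | insert a s ha ih =>
    have h := (hY a (mem_insert_self a s)).mul (ih fun i hi => hY i (mem_insert_of_mem hi))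
    simpa [prod_insert ha] using h

/-- Bounded measurable functions are integrable for a finite measure. [folklore] -/
theorem integrable (hf : IsBddMeas f) (μ : Measure Ω) [IsFiniteMeasure μ] : Integrable f μ := by
  obtain ⟨hfm, C, hC⟩ := hf
  exact Integrable.of_bound hfm.aestronglyMeasurable C
    (ae_of_all _ fun ω => by rw [Real.norm_eq_abs]; exact hC ω)

end IsBddMeas

variable (Ω) in
/-- The **submodule of bounded measurable real functions** on `Ω` (the domain of the multilinear mixed
coefficients). [folklore] -/
def bddMeas : Submodule ℝ (Ω → ℝ) where
  carrier := {f | IsBddMeas f}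
  add_mem' := fun hf hg => hf.add hg
  zero_mem' := IsBddMeas.const 0
  smul_mem' := fun c _ hf => hf.smul c

/-- Membership in `bddMeas` is `IsBddMeas`. [folklore] -/
@[simp] theorem mem_bddMeas {f : Ω → ℝ} : f ∈ bddMeas Ω ↔ IsBddMeas f := Iff.rfl

end BddMeas

/-! ## The mixed coefficients -/

section MixedCoeff

variable {Ω : Type*} [MeasurableSpace Ω] {ι : Type*} [DecidableEq ι]

/-- **Mixed coefficients by the moment recursion.**  `mixedCoeff μ X Y s` is defined by strong induction on the
finset `s`: `A(s) = ∫ X ∏_{i∈s} Yᵢ dμ − Σ_{t ⊊ s} A(t) ∫ ∏_{i∈s∖t} Yᵢ dμ`.  For a probability measure this is the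
recursion `∫ X ∏_{i∈s} Yᵢ = Σ_{t⊆s} A(t) ∫ ∏_{s∖t} Yᵢ` defining the joint cumulants `κ(X; (Yᵢ)_{i∈s})`. [folklore] -/
def mixedCoeff (μ : Measure Ω) (X : Ω → ℝ) (Y : ι → Ω → ℝ) : Finset ι → ℝ := fun s =>
  Finset.strongInduction
    (fun s ih => (∫ ω, X ω * ∏ i ∈ s, Y i ω ∂μ) -
      ∑ t ∈ s.ssubsets.attach, ih t.1 (mem_ssubsets.1 t.2) * ∫ ω, ∏ i ∈ s \ t.1, Y i ω ∂μ) s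

variable (μ : Measure Ω) (X : Ω → ℝ) (Y : ι → Ω → ℝ)

/-- The defining recursion of the mixed coefficients, unfolded once. [folklore] -/
theorem mixedCoeff_eq (s : Finset ι) :
    mixedCoeff μ X Y s = (∫ ω, X ω * ∏ i ∈ s, Y i ω ∂μ) -
      ∑ t ∈ s.ssubsets, mixedCoeff μ X Y t * ∫ ω, ∏ i ∈ s \ t, Y i ω ∂μ := by
  show Finset.strongInduction _ s = _
  rw [Finset.strongInduction_eq]
  congr 1
  exact Finset.sum_attach s.ssubsets (fun t => mixedCoeff μ X Y t * ∫ ω, ∏ i ∈ s \ t, Y i ω ∂μ)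

/-- **The moment recursion**: for a probability measure,
`∫ X ∏_{i∈s} Yᵢ dμ = Σ_{t ⊆ s} A(t) · ∫ ∏_{i∈s∖t} Yᵢ dμ`. [folklore] -/
theorem integral_mul_prod_eq_sum_mixedCoeff [IsProbabilityMeasure μ] (s : Finset ι) :
    ∫ ω, X ω * ∏ i ∈ s, Y i ω ∂μ =
      ∑ t ∈ s.powerset, mixedCoeff μ X Y t * ∫ ω, ∏ i ∈ s \ t, Y i ω ∂μ := by
  rw [← Finset.sum_erase_add _ _ (mem_powerset_self s)]
  have h : s.powerset.erase s = s.ssubsets := rfl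
  rw [h, mixedCoeff_eq μ X Y s]
  simp [sdiff_self]

variable {μ X Y}

/-- **Locality**: the mixed coefficient `A(s)` only reads the family on `s`. [folklore] -/
theorem mixedCoeff_congr {Y' : ι → Ω → ℝ} {s : Finset ι} (h : ∀ i ∈ s, Y i = Y' i) :
    mixedCoeff μ X Y s = mixedCoeff μ X Y' s := by
  induction s using Finset.strongInduction with
  | H s ih =>
    rw [mixedCoeff_eq, mixedCoeff_eq]
    have hprod : ∀ (u : Finset ι), u ⊆ s → ∀ ω, ∏ i ∈ u, Y i ω = ∏ i ∈ u, Y' i ω :=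
      fun u hu ω => prod_congr rfl fun i hi => by rw [h i (hu hi)]
    congr 1
    · exact integral_congr_ae (ae_of_all _ fun ω => by simp only [hprod s Subset.rfl ω])
    · refine sum_congr rfl fun t ht => ?_
      have hts := mem_ssubsets.1 ht
      rw [ih t hts fun i hi => h i (hts.subset hi)]
      congr 1
      exact integral_congr_ae (ae_of_all _ fun ω => hprod (s \ t) sdiff_subset ω)

/-! ### Linearity in each slot -/

section Linear

variable {μ : Measure Ω} [IsFiniteMeasure μ] {X : Ω → ℝ}

/-- Linearity of `∫ F · ∏_{j∈u} Yⱼ dμ` in the slot `i ∈ u` (families agreeing off `i`, bounded measurable). [folklore] -/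
theorem integral_mul_prod_slot_linear {F : Ω → ℝ} (hF : IsBddMeas F) {Y₁ Y₂ Y₃ : ι → Ω → ℝ}
    (h₁ : ∀ j, IsBddMeas (Y₁ j)) (h₂ : ∀ j, IsBddMeas (Y₂ j)) {i : ι} {a b : ℝ}
    (hoff₁ : ∀ j, j ≠ i → Y₁ j = Y₃ j) (hoff₂ : ∀ j, j ≠ i → Y₂ j = Y₃ j)
    (hi : Y₃ i = a • Y₁ i + b • Y₂ i) {u : Finset ι} (hu : i ∈ u) :
    ∫ ω, F ω * ∏ j ∈ u, Y₃ j ω ∂μ =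
      a * ∫ ω, F ω * ∏ j ∈ u, Y₁ j ω ∂μ + b * ∫ ω, F ω * ∏ j ∈ u, Y₂ j ω ∂μ := by
  have he₁ : ∀ ω, ∏ j ∈ u.erase i, Y₃ j ω = ∏ j ∈ u.erase i, Y₁ j ω := fun ω =>
    prod_congr rfl fun j hj => by rw [hoff₁ j (ne_of_mem_erase hj)]
  have he₂ : ∀ ω, ∏ j ∈ u.erase i, Y₃ j ω = ∏ j ∈ u.erase i, Y₂ j ω := fun ω =>
    prod_congr rfl fun j hj => by rw [hoff₂ j (ne_of_mem_erase hj)]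
  have hsplit : ∀ (Y : ι → Ω → ℝ) (ω : Ω), ∏ j ∈ u, Y j ω = Y i ω * ∏ j ∈ u.erase i, Y j ω :=
    fun Y ω => (mul_prod_erase u (fun j => Y j ω) hu).symm
  have hpt : ∀ ω, F ω * ∏ j ∈ u, Y₃ j ω =
      a * (F ω * ∏ j ∈ u, Y₁ j ω) + b * (F ω * ∏ j ∈ u, Y₂ j ω) := by
    intro ω
    rw [hsplit Y₃, hsplit Y₁, hsplit Y₂, hi, ← he₁ ω, ← he₂ ω]
    simp only [Pi.add_apply, Pi.smul_apply, smul_eq_mul]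
    ring
  have hI₁ : Integrable (fun ω => F ω * ∏ j ∈ u, Y₁ j ω) μ :=
    (hF.mul (IsBddMeas.prod u fun j _ => h₁ j)).integrable μ
  have hI₂ : Integrable (fun ω => F ω * ∏ j ∈ u, Y₂ j ω) μ :=
    (hF.mul (IsBddMeas.prod u fun j _ => h₂ j)).integrable μ
  simp_rw [hpt]
  rw [integral_add (hI₁.const_mul a) (hI₂.const_mul b), integral_const_mul, integral_const_mul]

omit [MeasurableSpace Ω] [DecidableEq ι] in
/-- Off the slot `i`, products over `u ∌ i` of families agreeing off `i` coincide. [folklore] -/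
theorem prod_eq_of_not_mem {Y₁ Y₃ : ι → Ω → ℝ} {i : ι} (hoff₁ : ∀ j, j ≠ i → Y₁ j = Y₃ j)
    {u : Finset ι} (hu : i ∉ u) (ω : Ω) : ∏ j ∈ u, Y₃ j ω = ∏ j ∈ u, Y₁ j ω :=
  prod_congr rfl fun j hj => by rw [hoff₁ j (ne_of_mem_of_not_mem hj hu)]

/-- **Linearity of the mixed coefficients in each slot.**  If three bounded measurable families agree off `i`
and `Y₃ i = a • Y₁ i + b • Y₂ i`, then for every `s ∋ i`, `A_{Y₃}(s) = a A_{Y₁}(s) + b A_{Y₂}(s)` (and for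
`s ∌ i` all three coincide, `mixedCoeff_congr`). [folklore] -/
theorem mixedCoeff_slot_linear (hX : IsBddMeas X) {Y₁ Y₂ Y₃ : ι → Ω → ℝ}
    (h₁ : ∀ j, IsBddMeas (Y₁ j)) (h₂ : ∀ j, IsBddMeas (Y₂ j)) {i : ι} {a b : ℝ}
    (hoff₁ : ∀ j, j ≠ i → Y₁ j = Y₃ j) (hoff₂ : ∀ j, j ≠ i → Y₂ j = Y₃ j)
    (hi : Y₃ i = a • Y₁ i + b • Y₂ i) {s : Finset ι} (hs : i ∈ s) :
    mixedCoeff μ X Y₃ s = a * mixedCoeff μ X Y₁ s + b * mixedCoeff μ X Y₂ s := by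
  induction s using Finset.strongInduction with
  | H s ih =>
    rw [mixedCoeff_eq (Y := Y₃), mixedCoeff_eq (Y := Y₁), mixedCoeff_eq (Y := Y₂)]
    rw [integral_mul_prod_slot_linear hX h₁ h₂ hoff₁ hoff₂ hi hs]
    -- split the sums over `t ⊊ s` according to `i ∈ t`
    rw [← sum_filter_add_sum_filter_not s.ssubsets (fun t => i ∈ t),
      ← sum_filter_add_sum_filter_not s.ssubsets (fun t => i ∈ t) (f := fun t =>
        mixedCoeff μ X Y₁ t * ∫ ω, ∏ j ∈ s \ t, Y₁ j ω ∂μ),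
      ← sum_filter_add_sum_filter_not s.ssubsets (fun t => i ∈ t) (f := fun t =>
        mixedCoeff μ X Y₂ t * ∫ ω, ∏ j ∈ s \ t, Y₂ j ω ∂μ)]
    -- `t ∋ i`: the coefficient is linear (induction), the complementary moment is common
    have hin : ∑ t ∈ s.ssubsets.filter (fun t => i ∈ t),
        mixedCoeff μ X Y₃ t * ∫ ω, ∏ j ∈ s \ t, Y₃ j ω ∂μ =
        ∑ t ∈ s.ssubsets.filter (fun t => i ∈ t),
          (a * (mixedCoeff μ X Y₁ t * ∫ ω, ∏ j ∈ s \ t, Y₁ j ω ∂μ) +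
            b * (mixedCoeff μ X Y₂ t * ∫ ω, ∏ j ∈ s \ t, Y₂ j ω ∂μ)) := by
      refine sum_congr rfl fun t ht => ?_
      obtain ⟨hts, hit⟩ := mem_filter.1 ht
      have hts' := mem_ssubsets.1 hts
      have hnot : i ∉ s \ t := fun h => (mem_sdiff.1 h).2 hit
      rw [ih t hts' hit]
      have e₁ : ∫ ω, ∏ j ∈ s \ t, Y₃ j ω ∂μ = ∫ ω, ∏ j ∈ s \ t, Y₁ j ω ∂μ :=
        integral_congr_ae (ae_of_all _ fun ω => prod_eq_of_not_mem hoff₁ hnot ω)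
      have e₂ : ∫ ω, ∏ j ∈ s \ t, Y₃ j ω ∂μ = ∫ ω, ∏ j ∈ s \ t, Y₂ j ω ∂μ :=
        integral_congr_ae (ae_of_all _ fun ω => prod_eq_of_not_mem hoff₂ hnot ω)
      rw [add_mul, mul_assoc, mul_assoc, ← e₁, ← e₂]
    -- `t ∌ i`: the coefficient is common (locality), the complementary moment is linear
    have hout : ∑ t ∈ s.ssubsets.filter (fun t => ¬ i ∈ t),
        mixedCoeff μ X Y₃ t * ∫ ω, ∏ j ∈ s \ t, Y₃ j ω ∂μ =
        ∑ t ∈ s.ssubsets.filter (fun t => ¬ i ∈ t),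
          (a * (mixedCoeff μ X Y₁ t * ∫ ω, ∏ j ∈ s \ t, Y₁ j ω ∂μ) +
            b * (mixedCoeff μ X Y₂ t * ∫ ω, ∏ j ∈ s \ t, Y₂ j ω ∂μ)) := by
      refine sum_congr rfl fun t ht => ?_
      obtain ⟨hts, hit⟩ := mem_filter.1 ht
      have hmem : i ∈ s \ t := mem_sdiff.2 ⟨hs, hit⟩
      have c₁ : mixedCoeff μ X Y₃ t = mixedCoeff μ X Y₁ t :=
        mixedCoeff_congr fun j hj => (hoff₁ j (ne_of_mem_of_not_mem hj hit)).symm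
      have c₂ : mixedCoeff μ X Y₃ t = mixedCoeff μ X Y₂ t :=
        mixedCoeff_congr fun j hj => (hoff₂ j (ne_of_mem_of_not_mem hj hit)).symm
      have hlin := integral_mul_prod_slot_linear (μ := μ) (IsBddMeas.const 1) h₁ h₂ hoff₁ hoff₂ hi hmem
      simp only [one_mul] at hlin
      rw [hlin, mul_add, ← c₁, ← c₂]
      ring
    rw [hin, hout, sum_add_distrib, sum_add_distrib, ← mul_sum, ← mul_sum, ← mul_sum, ← mul_sum]
    ring

end Linear

/-! ### Invariance under relabelling -/

section Transport

variable {μ : Measure Ω} {X : Ω → ℝ} {κ : Type*} [DecidableEq κ]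

/-- **Relabelling invariance**: for an embedding `e : ι ↪ κ`, the mixed coefficient of the family `Y ∘ e` on `s`
is the mixed coefficient of `Y` on `s.map e`. [folklore] -/
theorem mixedCoeff_map (e : ι ↪ κ) (Y : κ → Ω → ℝ) (s : Finset ι) :
    mixedCoeff μ X Y (s.map e) = mixedCoeff μ X (fun i => Y (e i)) s := by
  induction s using Finset.strongInduction with
  | H s ih =>
    rw [mixedCoeff_eq, mixedCoeff_eq]
    simp only [prod_map]
    congr 1
    symm
    refine sum_nbij' (fun t => t.map e) (fun t' => s.filter fun x => e x ∈ t') ?_ ?_ ?_ ?_ ?_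
    · intro t ht
      exact mem_ssubsets.2 (map_ssubset_map.2 (mem_ssubsets.1 ht))
    · intro t' ht'
      have hlt := mem_ssubsets.1 ht'
      refine mem_ssubsets.2 (filter_ssubset.2 ?_)
      obtain ⟨y, hy, hyt⟩ := exists_of_ssubset hlt
      obtain ⟨x, hx, rfl⟩ := mem_map.1 hy
      exact ⟨x, hx, hyt⟩
    · intro t ht
      have hts := (mem_ssubsets.1 ht).subset
      ext x
      simp only [mem_filter, mem_map' e]
      exact ⟨fun h => h.2, fun h => ⟨hts h, h⟩⟩
    · intro t' ht'
      have hts := (mem_ssubsets.1 ht').subset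
      ext y
      simp only [mem_map, mem_filter]
      constructor
      · rintro ⟨x, ⟨-, hx⟩, rfl⟩
        exact hx
      · intro hy
        obtain ⟨x, hx, rfl⟩ := mem_map.1 (hts hy)
        exact ⟨x, ⟨hx, hy⟩, rfl⟩
    · intro t ht
      rw [ih t (mem_ssubsets.1 ht), ← Finset.map_sdiff]
      simp only [prod_map]

end Transport

end MixedCoeff

/-! ## The multilinear packaging on `Fin n` and its symmetry -/

section Multilinear

variable {Ω : Type*} [MeasurableSpace Ω] (μ : Measure Ω) [IsFiniteMeasure μ] (X : bddMeas Ω) (n : ℕ)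

/-- **The mixed coefficient as a multilinear form** on `n` bounded measurable observables:
`Y ↦ A_X(Y₀, …, Y_{n−1})` (the full finset `univ : Finset (Fin n)`). [folklore] -/
def mixedCoeffML : MultilinearMap ℝ (fun _ : Fin n => bddMeas Ω) ℝ where
  toFun Y := mixedCoeff μ X (fun i => (Y i : Ω → ℝ)) univ
  map_update_add' := by
    intro _ m i x y
    have h := mixedCoeff_slot_linear (μ := μ) (X := (X : Ω → ℝ)) X.2
      (Y₁ := fun j => ((Function.update m i x j : bddMeas Ω) : Ω → ℝ))
      (Y₂ := fun j => ((Function.update m i y j : bddMeas Ω) : Ω → ℝ))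
      (Y₃ := fun j => ((Function.update m i (x + y) j : bddMeas Ω) : Ω → ℝ))
      (fun j => (Function.update m i x j).2) (fun j => (Function.update m i y j).2) (i := i) (a := 1) (b := 1)
      (fun j hj => by simp [Function.update_of_ne hj])
      (fun j hj => by simp [Function.update_of_ne hj])
      (by simp) (mem_univ i)
    simp only [one_mul] at h
    convert h using 3
  map_update_smul' := by
    intro _ m i c x
    have h := mixedCoeff_slot_linear (μ := μ) (X := (X : Ω → ℝ)) X.2
      (Y₁ := fun j => ((Function.update m i x j : bddMeas Ω) : Ω → ℝ))
      (Y₂ := fun j => ((Function.update m i x j : bddMeas Ω) : Ω → ℝ))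
      (Y₃ := fun j => ((Function.update m i (c • x) j : bddMeas Ω) : Ω → ℝ))
      (fun j => (Function.update m i x j).2) (fun j => (Function.update m i x j).2) (i := i) (a := c) (b := 0)
      (fun j hj => by simp [Function.update_of_ne hj])
      (fun j hj => by simp [Function.update_of_ne hj])
      (by simp) (mem_univ i)
    simp only [zero_mul, add_zero] at h
    rw [smul_eq_mul]
    convert h using 3

/-- The multilinear form evaluates to the mixed coefficient on `univ`. [folklore] -/
@[simp] theorem mixedCoeffML_apply (Y : Fin n → bddMeas Ω) :
    mixedCoeffML μ X n Y = mixedCoeff μ X (fun i => (Y i : Ω → ℝ)) univ := rfl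

/-- **Symmetry** of the multilinear mixed coefficient under permutations of the slots. [folklore] -/
theorem mixedCoeffML_perm (Y : Fin n → bddMeas Ω) (σ : Equiv.Perm (Fin n)) :
    mixedCoeffML μ X n (fun i => Y (σ i)) = mixedCoeffML μ X n Y := by
  simp only [mixedCoeffML_apply]
  have h := mixedCoeff_map (μ := μ) (X := (X : Ω → ℝ)) σ.toEmbedding (fun i => (Y i : Ω → ℝ)) univ
  rw [map_univ_equiv] at h
  simpa using h.symm

end Multilinear

/-- **Registered sub-goal `mixedCoeffML_symm` (line `Sketch`, stub `stub_derivToMoments`)**: the multilinear mixed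
coefficient of `n` bounded measurable observables is a SYMMETRIC multilinear form — the hypothesis of the landed sign
polarisation `sum_sign_smul_map_diag_eq_of_symmetric`. [folklore] -/
theorem mixedCoeffML_symm :
    ∀ (Ω : Type) [MeasurableSpace Ω] (μ : Measure Ω) [IsFiniteMeasure μ] (X : bddMeas Ω) (n : ℕ) (Y : Fin n → bddMeas Ω) (σ : Equiv.Perm (Fin n)), mixedCoeffML μ X n (fun i => Y (σ i)) = mixedCoeffML μ X n Y :=
  fun _ _ μ _ X n Y σ => mixedCoeffML_perm μ X n Y σ

end Summit.QuantumFields.YangMills.Cruxes.HypercubicLimit.CouplingResponse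

end
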